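import Literature.NumberTheory.Sieve.SmoothToSharpLayer
import Literature.NumberTheory.Sieve.SmoothProfileWeights
import HarnessLib

/-!
# Smooth product-weighted sums as integrals of sharp box counts (for the small moduli)

Topic `Literature/NumberTheory/Sieve`, sub-namespace `SmoothViaBoxes`. For the small moduli
`N𝔣 ≤ (log M)^{B₁}` Hinz (p. 178) feeds the sharp box counts of Mitsui's prime number theorem for
residue classes into the character sums. With smooth weights this requires expressing a smoothly
weighted sum through counts over the sub-boxes `∏_w (0, M s_w]`: if `g_w ∈ C¹_c((0,∞))` then
`g_w(r) = −∫_{s ≥ r} g_w'(s) ds`, so for totally positive `α` and any coefficients `f`,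

`∑_{α ∈ S} (∏_w g_w(σ_wα/M)) f(α) = (−1)^d ∫_{s ∈ ℝ^d} (∏_w g_w'(s_w)) · (∑_{α ∈ S, σ_wα ≤ M s_w ∀w} f(α)) ds`

(`sum_prodWeight_eq_integral`). Hence (`norm_sum_prodWeight_le`) a uniform bound
`|∑_{α ∈ S, σα ≤ Ms} f(α)| ≤ E` on the support of `∏ g_w'` gives
`|∑_{α∈S} (∏ g_w(σ_wα/M)) f(α)| ≤ (∏_w ‖g_w'‖₁) · E`.

## References

* J. Hinz, Acta Arith. 51 (1988), §2 p. 178 (small moduli via Mitsui's theorem).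
  [cite: Hinz1988, §2 p. 178]
-/

noncomputable section

open Finset NumberField NumberField.InfinitePlace MeasureTheory Set
  Literature.NumberTheory.Sieve.NumberFieldLS Literature.NumberTheory.LFunctions
  Literature.NumberTheory.LFunctions.NumberField Literature.NumberTheory.Sieve.TypeTwoReparam
  Literature.NumberTheory.Sieve.TypeTwoBlock Literature.NumberTheory.Sieve.SmoothCoset
open scoped Classical

namespace Literature.NumberTheory.Sieve.SmoothViaBoxes

variable {K : Type*} [Field K] [NumberField K] [IsTotallyReal K]

local notation "d" => Module.finrank ℚ K
local notation "RP" => {w : InfinitePlace K // IsReal w}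

/-! ## One variable: `g(r) = −∫_{s ≥ r} g'(s) ds` -/

omit [IsTotallyReal K] in
/-- **`g(r) = −∫_{s > r} g'(s) ds`** for `g ∈ C¹` with compact support. [folklore] -/
theorem eq_neg_integral_deriv_Ioi {g : ℝ → ℝ} (hg : ContDiff ℝ 1 g) (hs : HasCompactSupport g) (r : ℝ) :
    g r = -∫ s in Ioi r, deriv g s := by
  have hd : ∀ x, HasDerivAt g (deriv g x) x := fun x => (hg.differentiable one_ne_zero x).hasDerivAt
  have hcont : Continuous (deriv g) := hg.continuous_deriv le_rfl
  have hint : IntegrableOn (deriv g) (Ioi r) := (hcont.integrable_of_hasCompactSupport hs.deriv).integrableOn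
  have htend : Filter.Tendsto g Filter.atTop (nhds 0) :=
    (hs.is_zero_at_infty : Filter.Tendsto g (Filter.cocompact ℝ) (nhds 0)).mono_left (atTop_le_cocompact (α := ℝ))
  rw [integral_Ioi_of_hasDerivAt_of_tendsto (hg.continuous.continuousWithinAt) (fun x _ => hd x) hint htend]
  ring

omit [IsTotallyReal K] in
/-- The same with the indicator inside: `g(r) = −∫ 1[r ≤ s] g'(s) ds`. [folklore] -/
theorem eq_neg_integral_indicator_deriv {g : ℝ → ℝ} (hg : ContDiff ℝ 1 g) (hs : HasCompactSupport g) (r : ℝ) :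
    g r = -∫ s, (Ici r).indicator (deriv g) s := by
  rw [integral_indicator measurableSet_Ici, integral_Ici_eq_integral_Ioi, eq_neg_integral_deriv_Ioi hg hs r]

/-! ## The product weight as an integral over `ℝ^d` -/

/-- **`∏_w g_w(r_w) = (−1)^d ∫_s ∏_w 1[r_w ≤ s_w] g_w'(s_w) ds`.** [folklore] -/
theorem prodWeight_eq_integral {g : RP → ℝ → ℝ} (hg : ∀ w, ContDiff ℝ 1 (g w)) (hs : ∀ w, HasCompactSupport (g w))
    (r : RP → ℝ) :
    (∏ w, g w (r w) : ℝ) = (-1) ^ d * ∫ s : RP → ℝ, ∏ w, (Ici (r w)).indicator (deriv (g w)) (s w) := by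
  rw [integral_fintype_prod_volume_eq_prod (fun w x => (Ici (r w)).indicator (deriv (g w)) x)]
  rw [Finset.prod_congr rfl fun w _ => eq_neg_integral_indicator_deriv (hg w) (hs w) (r w), Finset.prod_neg,
    Finset.card_univ, card_RP_eq]

omit [IsTotallyReal K] in
/-- The integrand of `prodWeight_eq_integral` is integrable. [folklore] -/
theorem integrable_prod_indicator_deriv {g : RP → ℝ → ℝ} (hg : ∀ w, ContDiff ℝ 1 (g w))
    (hs : ∀ w, HasCompactSupport (g w)) (r : RP → ℝ) :
    Integrable (fun s : RP → ℝ => ∏ w, (Ici (r w)).indicator (deriv (g w)) (s w)) := by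
  refine Integrable.fintype_prod (f := fun w x => (Ici (r w)).indicator (deriv (g w)) x) fun w => ?_
  exact (((hg w).continuous_deriv le_rfl).integrable_of_hasCompactSupport (hs w).deriv).indicator measurableSet_Ici

/-! ## The sum -/

/-- **Smoothly weighted sums through box counts**:
`∑_{α∈S} (∏_w g_w(σ_wα/M)) f(α) = (−1)^d ∫_s (∏_w g_w'(s_w)) ∑_{α∈S, σ_wα ≤ M s_w} f(α) ds` (`M > 0`).
[cite: Hinz1988, §2 p. 178] -/
theorem sum_prodWeight_eq_integral {g : RP → ℝ → ℝ} (hg : ∀ w, ContDiff ℝ 1 (g w))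
    (hs : ∀ w, HasCompactSupport (g w)) {M : ℝ} (hM : 0 < M) (S : Finset (𝓞 K)) (f : 𝓞 K → ℂ) :
    ∑ α ∈ S, ((∏ w, g w (remb K (α : K) w / M) : ℝ) : ℂ) * f α =
      (-1) ^ d * ∫ s : RP → ℝ, ((∏ w, deriv (g w) (s w) : ℝ) : ℂ) *
        ∑ α ∈ S.filter (fun α : 𝓞 K => ∀ w, remb K ((α : 𝓞 K) : K) w ≤ M * s w), f α := by
  -- per `α`
  have hα : ∀ α : 𝓞 K, ((∏ w, g w (remb K (α : K) w / M) : ℝ) : ℂ) * f α =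
      (-1) ^ d * ∫ s : RP → ℝ, ((∏ w, (Ici (remb K (α : K) w / M)).indicator (deriv (g w)) (s w) : ℝ) : ℂ) * f α := by
    intro α
    rw [prodWeight_eq_integral hg hs]
    push_cast
    rw [← integral_complex_ofReal, mul_assoc, ← integral_mul_const]
    congr 1
    refine integral_congr_ae (Filter.Eventually.of_forall fun s => ?_)
    push_cast
    rfl
  rw [Finset.sum_congr rfl fun α _ => hα α, ← Finset.mul_sum]
  congr 1
  have hint : ∀ α ∈ S, Integrable (fun s : RP → ℝ =>
      ((∏ w, (Ici (remb K (α : K) w / M)).indicator (deriv (g w)) (s w) : ℝ) : ℂ) * f α) :=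
    fun α _ => ((integrable_prod_indicator_deriv hg hs _).ofReal).mul_const _
  rw [← integral_finsetSum _ hint]
  refine integral_congr_ae (Filter.Eventually.of_forall fun s => ?_)
  -- pointwise: `∑_α (∏ 1[r_w ≤ s_w] g') f = (∏ g') ∑_{α : r ≤ s} f`
  simp only
  rw [Finset.sum_filter, Finset.mul_sum]
  refine Finset.sum_congr rfl fun α _ => ?_
  by_cases hle : ∀ w, remb K (α : K) w ≤ M * s w
  · rw [if_pos hle]
    congr 2
    refine Finset.prod_congr rfl fun w _ => ?_
    rw [indicator_of_mem]
    rw [Set.mem_Ici, div_le_iff₀ hM, mul_comm]; exact hle w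
  · rw [if_neg hle, mul_zero]
    push Not at hle
    obtain ⟨w, hw⟩ := hle
    have : (Ici (remb K (α : K) w / M)).indicator (deriv (g w)) (s w) = 0 := by
      rw [indicator_of_notMem]
      rw [Set.mem_Ici, not_le, lt_div_iff₀ hM, mul_comm]; exact hw
    rw [Finset.prod_eq_zero (Finset.mem_univ w) this]
    simp

/-- **The resulting bound**: if `|∑_{α∈S, σα ≤ Ms} f(α)| ≤ E` for every `s` with `∏ g_w'(s_w) ≠ 0`,
then `|∑_{α∈S} (∏_w g_w(σ_wα/M)) f(α)| ≤ (∏_w ‖g_w'‖₁) E`. [cite: Hinz1988, §2 p. 178] -/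
theorem norm_sum_prodWeight_le {g : RP → ℝ → ℝ} (hg : ∀ w, ContDiff ℝ 1 (g w))
    (hs : ∀ w, HasCompactSupport (g w)) {M : ℝ} (hM : 0 < M) (S : Finset (𝓞 K)) (f : 𝓞 K → ℂ) {E : ℝ}
    (hE : ∀ s : RP → ℝ, (∏ w, deriv (g w) (s w)) ≠ 0 →
      ‖∑ α ∈ S.filter (fun α : 𝓞 K => ∀ w, remb K ((α : 𝓞 K) : K) w ≤ M * s w), f α‖ ≤ E) :
    ‖∑ α ∈ S, ((∏ w, g w (remb K (α : K) w / M) : ℝ) : ℂ) * f α‖ ≤ (∏ w, ∫ x, ‖deriv (g w) x‖) * E := by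
  rw [sum_prodWeight_eq_integral hg hs hM S f, norm_mul, norm_pow, norm_neg, norm_one, one_pow, one_mul]
  have hgi : ∀ w, Integrable (deriv (g w)) := fun w =>
    ((hg w).continuous_deriv le_rfl).integrable_of_hasCompactSupport (hs w).deriv
  calc ‖∫ s : RP → ℝ, ((∏ w, deriv (g w) (s w) : ℝ) : ℂ) *
        ∑ α ∈ S.filter (fun α : 𝓞 K => ∀ w, remb K ((α : 𝓞 K) : K) w ≤ M * s w), f α‖
      ≤ ∫ s : RP → ℝ, (∏ w, ‖deriv (g w) (s w)‖) * E := by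
        refine (norm_integral_le_integral_norm _).trans (integral_mono_of_nonneg (Filter.Eventually.of_forall fun _ => norm_nonneg _)
          ((Integrable.fintype_prod (f := fun w x => ‖deriv (g w) x‖) fun w => (hgi w).norm).mul_const E)
          (Filter.Eventually.of_forall fun s => ?_))
        simp only
        rw [norm_mul, Complex.norm_real, Real.norm_eq_abs, Finset.abs_prod]
        have hnorm : (∏ w, ‖deriv (g w) (s w)‖) = ∏ w, |deriv (g w) (s w)| :=
          Finset.prod_congr rfl fun w _ => Real.norm_eq_abs _
        rw [hnorm]
        by_cases h0 : (∏ w, deriv (g w) (s w)) = 0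
        · have hz : (∏ w, |deriv (g w) (s w)|) = 0 := by rw [← Finset.abs_prod, h0, abs_zero]
          rw [hz, zero_mul, zero_mul]
        · exact mul_le_mul_of_nonneg_left (hE s h0) (Finset.prod_nonneg fun _ _ => abs_nonneg _)
    _ = (∏ w, ∫ x, ‖deriv (g w) x‖) * E := by
        rw [integral_mul_const, integral_fintype_prod_volume_eq_prod (fun w x => ‖deriv (g w) x‖)]

end Literature.NumberTheory.Sieve.SmoothViaBoxes
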